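import Literature.NumberTheory.EllipticCurves.ThreeIsogenySelmerRankZeroProportionProofs
import Literature.NumberTheory.EllipticCurves.BSDWave0Proofs
import Literature.NumberTheory.EllipticCurves.SelmerTrivialCorankProofs
import HarnessLib

/-!
# Bhargava–Klagsbrun–Lemke Oliver–Shnidman 2019: the case `F^*/F^{*2} = T₀(φ)` (proof of Thm. 2.7,
# Example 13.2) replayed in the kernel

Cross-ladder literature-typing layer (cell `bsd-littype`, seat 08, gen 8). Theorems only (no
definitions, no named facts). Source: Bhargava–Klagsbrun–Lemke Oliver–Shnidman, Duke Math. J.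
**168** (2019) = arXiv:1709.09790 (REFEREED; held text `paper:arxiv-1709.09790`), §11 "Proof of
Theorem (cm)" (chunk p0017 L58–L62) and §9.1–9.2 (chunk p0014).

BKLOS prove their Theorem 2.7 (the theorem Burungale–Tian, Ann. of Math. 203 (2026), cite as "[1,
Thm. 2.7]" for their Thm. 3.5; the tree's REFEREED binder `thm27_cm_averageRank_le_one`) in two
steps (p0017 L58–L62): (1) Theorem 11.2 — for a `3`-isogeny `φ : E → E'` with
`End(E) ≃ End(E') ≃ 𝓞_K` one has `c(φ) = 1` — applied to every twist: "It follows from Theorem (cm1)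
that `c(φ_s) = 1` for all `s ∈ F^*/F^{*2}`, or in other words, `F^*/F^{*2} = T₀(φ)`"; (2) "We
conclude from Theorem (globalbounds) that the average rank of `E_s(F)` is at most `1`, and that at
least `50%` of twists `E_s` have rank `0`." The same step (2) is their Example 13.2 (a non-CM curve
over `ℚ(√−3)` all of whose twists lie in `T₀(φ)`, p0021 L12).

This file replays STEP (2) in the kernel from the four REFEREED named facts of
`IsogenySelmerGroups.lean` / `IsogenySelmerGroupsComposite.lean` (`thm21_averageCard_selmerGroup`,
`casselsFormula_selmerRatio`, `selmerRank_parity_of_isInSelmerRatioClass`,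
`lemma91_selmerGroup_exact`) and the gen-6 `T₀` file, with NO framework hypothesis left: when
`T₀(φ)` is all of `F^*/F^{*2}` it is trivially "cut out by finitely many local conditions" (none:
`isDefinedByFinitelyManyLocalConditions_univ`) and has density `1` (`hasSquareClassDensity_true`),
so the hypotheses `hloc`/`hμ` of `squareClassProportionGe_selmerGroup_trivial_of_facts'` and
`squareClassAverageLe_selmerRankThree_T0` discharge themselves. What remains of Theorem 2.7 after
this file is exactly STEP (1): BKLOS Thm. 11.2 (`c(φ) = 1` for maximal CM, via the local theory of
§10 and Rubin's good twists) together with the existence of the `3`-isogeny `E → E/E[𝔭]` with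
maximal endomorphism rings (p0017 L58–L60) — not typed here (no consumer-free debt, D-0026).

## Main statement

`BhargavaKlagsbrunLemkeOliverShnidman2019.thm27_conclusions_of_forall_selmerRatio_eq_one`: granted
the four facts, for a `3`-isogeny dual pair `(φ, φ̂)` over a number field (models with
`a₁ = a₃ = 0`) with `c(φ_s) = 1` for every `s ∈ F^*`: the average of `rk E_s(F)` over all square
classes (ordered by height) is at most `1`, at least `50%` of the classes have `rk E_s(F) = 0`, and
at least `50%` have `Sel^{(3)}(E_s/F) = 0` (every representative) — the two conclusions of
`thm27_cm_averageRank_le_one` plus the Selmer form Burungale–Tian's Thm. 3.5 uses.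

## References

* [BhargavaKlagsbrunLemkeOliverShnidman2019] Duke Math. J. 168 (2019), §11 proof of Thm. (cm)
  (chunk p0017 L58–L62), Thm. 2.7 (chunk p0006 L1–L2), §9.1–9.2 (chunk p0014 L31–L47), Example 13.2
  (chunk p0021 L12).
* [BurungaleTian2026] Ann. of Math. 203 (2026), §3.2.2 (Thm. 3.5 from "[1, Thm. 2.7]").
* [SilvermanAEC2009] X.§4 (Thm. X.4.2: `3^{rk} ≤ #Sel^{(3)}`).
-/

noncomputable section

open scoped Classical NumberField
open Filter Topology
open WeierstrassCurve IsDedekindDomain NumberField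

universe u

namespace Literature.NumberTheory.EllipticCurves

/-! ## §1 `F^*/F^{*2}` itself: no local conditions, density `1`; rank versus `3`-Selmer rank -/

section Univ

variable {K : Type u} [Field K] [NumberField K]

/-- **The whole of `F^*/F^{*2}` is "defined by finitely many local conditions"** (none: `Σ_𝔭 =
F_𝔭^*/F_𝔭^{*2}` for every `𝔭`, BKLOS §2 p0004 L20), so Theorem 2.1 applies to `Σ = F^*/F^{*2}` —
as BKLOS use it in the proof of Thm. 2.7 ("`F^*/F^{*2} = T₀(φ)`", p0017 L60).
[cite: BhargavaKlagsbrunLemkeOliverShnidman2019, §2 (chunk p0004 L19–L21) with §11 (chunk p0017 L60)] -/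
theorem isDefinedByFinitelyManyLocalConditions_univ :
    IsDefinedByFinitelyManyLocalConditions (Set.univ : Set (SquareClass K)) :=
  ⟨∅, fun _ ↦ Set.univ, fun _ ↦ Set.univ, by ext t; simp⟩

/-- **"`Sel₃(E_s)` … is itself an upper bound on the rank of `E_s(F)`"** (BKLOS §9.1, p0014 L40–L41)
at the representative: `rk E_t(F) ≤ log₃ #Sel^{(3)}(E_t/F)` (descent, the tree's
`WeierstrassCurve.pow_rank_le_card_selmerGroup`: `3^{rk} ≤ #Sel^{(3)}`, a power of `3`).
[cite: BhargavaKlagsbrunLemkeOliverShnidman2019, §9.1 (chunk p0014 L40–L41)]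
[cite: SilvermanAEC2009, X.§4 (Thm. X.4.2)] -/
theorem twistMordellWeilRank_le_natLog_card_selmerGroup_three (V : WeierstrassCurve K)
    [V.IsElliptic] (t : SquareClass K) :
    twistMordellWeilRank V t ≤
      Nat.log 3 (Nat.card ((V.quadraticTwist ((Quotient.out t : Kˣ) : K)).selmerGroup 3)) := by
  haveI := V.isElliptic_quadraticTwist (Units.ne_zero (Quotient.out t : Kˣ))
  obtain ⟨r, hr⟩ :=
    exists_natCard_selmerGroup_three_eq_pow (V.quadraticTwist ((Quotient.out t : Kˣ) : K))
  have hpow := (V.quadraticTwist ((Quotient.out t : Kˣ) : K)).pow_rank_le_card_selmerGroup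
    (n := 3) (by norm_num)
  simp only [Nat.cast_ofNat] at hpow
  rw [hr] at hpow
  unfold twistMordellWeilRank
  rw [hr, Nat.log_pow (by norm_num)]
  exact (Nat.pow_le_pow_iff_right (by norm_num)).mp hpow

/-- `Sel^{(3)}(E_s/F) = 0` for every representative gives `rk E_s(F) = 0` for every representative
(`3^{rk} ≤ #Sel^{(3)}`). [cite: BhargavaKlagsbrunLemkeOliverShnidman2019, §9.2 (chunk p0014 L45–L46, "at least 50% of the twists in T_0(φ) have rank 0")]
[cite: SilvermanAEC2009, X.§4 (Thm. X.4.2)] -/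
theorem twistClassSatisfies_rank_zero_of_selmerGroup_trivial (V : WeierstrassCurve K)
    [V.IsElliptic] {t : SquareClass K}
    (ht : TwistClassSatisfies V (fun E : WeierstrassCurve K ↦ Nat.card (E.selmerGroup 3) = 1) t) :
    TwistClassSatisfies V (fun E : WeierstrassCurve K ↦ E.mordellWeilRank = 0) t := by
  intro s hs
  have h1 : Nat.card ((V.quadraticTwist (s : K)).selmerGroup 3) = 1 := ht s hs
  haveI := V.isElliptic_quadraticTwist (Units.ne_zero s)
  have hpow := (V.quadraticTwist (s : K)).pow_rank_le_card_selmerGroup (n := 3) (by norm_num)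
  simp only [Nat.cast_ofNat] at hpow
  rw [h1] at hpow
  show (V.quadraticTwist (s : K)).mordellWeilRank = 0
  by_contra hr
  have h3 : 3 ≤ 3 ^ (V.quadraticTwist (s : K)).mordellWeilRank := Nat.le_self_pow hr 3
  omega

end Univ

/-! ## §2 `F^*/F^{*2} = T₀(φ)`: the conclusions of Theorem 2.7 from the four facts -/

namespace BhargavaKlagsbrunLemkeOliverShnidman2019

variable {K : Type} [Field K] [NumberField K] {V V' : WeierstrassCurve K} [V.IsElliptic]
  [V'.IsElliptic] [V.IsCharNeTwoNF] [V'.IsCharNeTwoNF]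

omit [V.IsElliptic] [V'.IsElliptic] in
/-- "`c(φ_s) = 1` for all `s ∈ F^*/F^{*2}`, or in other words, `F^*/F^{*2} = T₀(φ)`" (p0017 L60):
if every twisted Selmer ratio is `1` then every square class lies in `T₀(φ)`
(`t(φ_s) = ord₃ 1 = 0` for every representative).
[cite: BhargavaKlagsbrunLemkeOliverShnidman2019, §11 (chunk p0017 L60)] -/
theorem isInSelmerRatioClass_zero_of_forall_selmerRatio_eq_one (φ : Isogeny V V')
    (hc : ∀ s : Kˣ, selmerRatio (φ.quadraticTwist (Units.ne_zero s)) = 1) (t : SquareClass K) :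
    IsInSelmerRatioClass φ 0 t := by
  intro s _
  simp only [logSelmerRatio, hc s, padicValRat.one, Int.natAbs_zero]

/-- **The conclusions of BKLOS Theorem 2.7 when `F^*/F^{*2} = T₀(φ)`, derived in the kernel** (the
deduction "We conclude from Theorem (globalbounds) that the average rank of `E_s(F)` is at most `1`,
and that at least `50%` of twists `E_s` have rank `0`", p0017 L60–L62, used verbatim also in Example
13.2): granted the four REFEREED facts (Thm. 2.1, Cassels' formula (9.2), the parity of BES Prop.
42 (ii), Lemma 9.1), for a `3`-isogeny `φ : E → E'` with dual `φ̂` over a number field (models with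
`a₁ = a₃ = 0`) such that `c(φ_s) = 1` for EVERY `s ∈ F^*` (the conclusion of BKLOS Thm. 11.2 for all
twists in the CM case): (i) the average of `rk E_s(F)` over `F^*/F^{*2}` ordered by height is at most
`1`; (ii) at least `50%` of the square classes carry twists of rank `0`; (iii) at least `50%` carry
twists with `Sel^{(3)}(E_s/F) = 0` (the Selmer form behind Burungale–Tian's Thm. 3.5). No framework
hypothesis remains: `T₀(φ) = F^*/F^{*2}` is cut out by no local condition and has density `1`.
[cite: BhargavaKlagsbrunLemkeOliverShnidman2019, §11 proof of Thm. (cm) (chunk p0017 L58–L62) with Thm. 2.7 (chunk p0006 L1–L2) and §9.1–9.2 (chunk p0014 L33–L46)]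
[cite: BurungaleTian2026, §3.2.2 (Thm. 3.5 from "[1, Thm. 2.7]")] -/
theorem thm27_conclusions_of_forall_selmerRatio_eq_one
    (h21 : thm21_averageCard_selmerGroup) (hC : casselsFormula_selmerRatio)
    (hP : selmerRank_parity_of_isInSelmerRatioClass) (h91 : lemma91_selmerGroup_exact)
    (φ : Isogeny V V') (ψ : Isogeny V' V) (hφ : φ.degree = 3) (hψ : ψ.degree = 3)
    (hψφ : ∀ P, ψ (φ P) = (3 : ℤ) • P) (hφψ : ∀ Q, φ (ψ Q) = (3 : ℤ) • Q)
    (hc : ∀ s : Kˣ, selmerRatio (φ.quadraticTwist (Units.ne_zero s)) = 1) :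
    SquareClassAverageLe Set.univ (fun t ↦ (twistMordellWeilRank V t : ℝ)) 1 ∧
      SquareClassProportionGe
        (TwistClassSatisfies V fun E : WeierstrassCurve K ↦ E.mordellWeilRank = 0) (1 / 2) ∧
      SquareClassProportionGe
        (TwistClassSatisfies V fun E : WeierstrassCurve K ↦ Nat.card (E.selmerGroup 3) = 1)
        (1 / 2) := by
  have hT0 := isInSelmerRatioClass_zero_of_forall_selmerRatio_eq_one φ hc
  -- `T₀(φ) = F^*/F^{*2}`
  have hS : {t : SquareClass K | IsInSelmerRatioClass φ 0 t} = Set.univ :=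
    Set.eq_univ_of_forall fun t ↦ hT0 t
  have hne : {t : SquareClass K | IsInSelmerRatioClass φ 0 t}.Nonempty := by
    rw [hS]; exact Set.univ_nonempty
  have hloc : IsDefinedByFinitelyManyLocalConditions
      {t : SquareClass K | IsInSelmerRatioClass φ 0 t} := by
    rw [hS]; exact isDefinedByFinitelyManyLocalConditions_univ
  -- density `1`
  have hμ : HasSquareClassDensity (IsInSelmerRatioClass φ 0) 1 := by
    have e : (IsInSelmerRatioClass φ 0 : SquareClass K → Prop) = fun _ ↦ True :=
      funext fun t ↦ propext ⟨fun _ ↦ trivial, fun _ ↦ hT0 t⟩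
    rw [e]
    exact hasSquareClassDensity_true
  -- (iii) Selmer form of (a), proportion `1/2`
  have hsel : SquareClassProportionGe
      (TwistClassSatisfies V fun E : WeierstrassCurve K ↦ Nat.card (E.selmerGroup 3) = 1)
      (1 / 2) :=
    squareClassProportionGe_selmerGroup_trivial_of_facts' h21 hC hP h91 φ ψ hφ hψ hψφ hφψ hloc hμ
  refine ⟨?_, ?_, hsel⟩
  · -- (i) average rank ≤ average `3`-Selmer rank ≤ 1
    have havg := squareClassAverageLe_selmerRankThree_T0 h21 hC h91 φ ψ hφ hψ hψφ hφψ hne hloc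
    rw [hS] at havg
    exact SquareClassAverageLe.mono
      (fun t _ ↦ by exact_mod_cast twistMordellWeilRank_le_natLog_card_selmerGroup_three V t) havg
  · -- (ii) rank `0` for at least `50%`
    exact SquareClassProportionGe.of_imp_off_finite Set.finite_empty
      (fun t _ ht ↦ twistClassSatisfies_rank_zero_of_selmerGroup_trivial V ht) hsel

/-- **The same, read as an average `3`-Selmer rank bound** ("the average of the rank of `Sel₃(E_s)`
for `s ∈ T₀(φ)` is at most `1`", p0014 L43, with `T₀(φ) = F^*/F^{*2}`): granted Thm. 2.1, Cassels'
formula and Lemma 9.1, if `c(φ_s) = 1` for every `s` then the average over all square classes of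
`log₃ #Sel^{(3)}(E_s/F)` (at the representative) is at most `1`.
[cite: BhargavaKlagsbrunLemkeOliverShnidman2019, §9.1–9.2 (chunk p0014 L33–L43) with §11 (chunk p0017 L60)] -/
theorem squareClassAverageLe_selmerRankThree_univ_of_forall_selmerRatio_eq_one
    (h21 : thm21_averageCard_selmerGroup) (hC : casselsFormula_selmerRatio)
    (h91 : lemma91_selmerGroup_exact) (φ : Isogeny V V') (ψ : Isogeny V' V) (hφ : φ.degree = 3)
    (hψ : ψ.degree = 3) (hψφ : ∀ P, ψ (φ P) = (3 : ℤ) • P) (hφψ : ∀ Q, φ (ψ Q) = (3 : ℤ) • Q)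
    (hc : ∀ s : Kˣ, selmerRatio (φ.quadraticTwist (Units.ne_zero s)) = 1) :
    SquareClassAverageLe Set.univ (fun t ↦ (Nat.log 3 (Nat.card
      ((V.quadraticTwist ((Quotient.out t : Kˣ) : K)).selmerGroup 3)) : ℝ)) 1 := by
  have hT0 := isInSelmerRatioClass_zero_of_forall_selmerRatio_eq_one φ hc
  have hS : {t : SquareClass K | IsInSelmerRatioClass φ 0 t} = Set.univ :=
    Set.eq_univ_of_forall fun t ↦ hT0 t
  have hne : {t : SquareClass K | IsInSelmerRatioClass φ 0 t}.Nonempty := by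
    rw [hS]; exact Set.univ_nonempty
  have hloc : IsDefinedByFinitelyManyLocalConditions
      {t : SquareClass K | IsInSelmerRatioClass φ 0 t} := by
    rw [hS]; exact isDefinedByFinitelyManyLocalConditions_univ
  have havg := squareClassAverageLe_selmerRankThree_T0 h21 hC h91 φ ψ hφ hψ hψφ hφψ hne hloc
  rwa [hS] at havg

/-! ## §3 Burungale–Tian 2026, Thm. 3.5: its conclusion in the `Sel_{3^∞}`-corank currency -/

/-- **The conclusion of Burungale–Tian, Ann. of Math. 203 (2026), Thm. 3.5 — "for at least `50%` of
`t ∈ K^×/(K^×)²`, `corank_{ℤ₃} Sel_{3^∞}(E^{(t)}/K) = 0`" — from the four BKLOS facts, for a curve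
all of whose twists lie in `T₀(φ)`.** Burungale–Tian cite "[1, Thm. 2.7]" (§3.2.2, p. 7); the
printed Thm. 2.7 says "rank `0`", and the Selmer statement they use is what BKLOS §9.2 actually
proves ("at least `50%` of the twists in `T₀(φ)` have [`Sel₃ = 0`, hence] rank `0`", p0014 L45–L46;
the tree's citation-precision note F-g2-3). Granted the four REFEREED facts, for a `3`-isogeny dual
pair `(φ, φ̂)` over a number field (models with `a₁ = a₃ = 0`) with `c(φ_s) = 1` for every `s`
(BKLOS Thm. 11.2's conclusion for all twists in the CM case, p0017 L60): at least `50%` of the square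
classes carry twists with `corank_{ℤ₃} Sel_{3^∞}(E_s/K) = 0` — via `Sel^{(3)}(E_s) = 0 ⟹
Sel_{3^∞}(E_s) = 0` (the tree's fact-free `selmerCorank_eq_zero_of_natCard_selmerGroup_eq_one_factFree`).
This is the conclusion of the binder `burungaleTian_thm35_selmerCorank_three_twists` for `E = V`;
what it does not supply is the CM input (Thm. 11.2 + the `𝔭`-isogeny `E → E/E[𝔭]`, p0017 L58–L60).
[cite: BurungaleTian2026, Thm. 3.5 (§3.2.2, p. 7, "[1, Thm. 2.7]")]
[cite: BhargavaKlagsbrunLemkeOliverShnidman2019, §9.2 (chunk p0014 L45–L46) with §11 (chunk p0017 L58–L62)] -/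
theorem squareClassProportionGe_selmerCorank_three_zero_half_of_forall_selmerRatio_eq_one
    (h21 : thm21_averageCard_selmerGroup) (hC : casselsFormula_selmerRatio)
    (hP : selmerRank_parity_of_isInSelmerRatioClass) (h91 : lemma91_selmerGroup_exact)
    (φ : Isogeny V V') (ψ : Isogeny V' V) (hφ : φ.degree = 3) (hψ : ψ.degree = 3)
    (hψφ : ∀ P, ψ (φ P) = (3 : ℤ) • P) (hφψ : ∀ Q, φ (ψ Q) = (3 : ℤ) • Q)
    (hc : ∀ s : Kˣ, selmerRatio (φ.quadraticTwist (Units.ne_zero s)) = 1) :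
    SquareClassProportionGe
      (TwistClassSatisfies V fun E : WeierstrassCurve K ↦ E.selmerCorank 3 = 0) (1 / 2) := by
  haveI : Fact (Nat.Prime 3) := ⟨Nat.prime_three⟩
  obtain ⟨-, -, hsel⟩ :=
    thm27_conclusions_of_forall_selmerRatio_eq_one h21 hC hP h91 φ ψ hφ hψ hψφ hφψ hc
  refine SquareClassProportionGe.of_imp_off_finite Set.finite_empty (fun t _ ht s hs ↦ ?_) hsel
  have h1 : Nat.card ((V.quadraticTwist (s : K)).selmerGroup 3) = 1 := ht s hs
  haveI := V.isElliptic_quadraticTwist (Units.ne_zero s)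
  have h0 := selmerCorank_eq_zero_of_natCard_selmerGroup_eq_one_factFree
    (V.quadraticTwist (s : K)) 3 (by simpa only [Nat.cast_ofNat] using h1)
  exact h0

end BhargavaKlagsbrunLemkeOliverShnidman2019

end Literature.NumberTheory.EllipticCurves
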